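import Mathlib
import Literature.MathematicalPhysics.QuantumFieldTheory.Balaban1983to89.B9Eq395Small
import Literature.MathematicalPhysics.QuantumFieldTheory.Balaban1983to89.B6RandomWalkHom

/-!
# `Balaban1983to89.B9Eq395Hom` — the p. 412 factor Q′[G′_{□₀}, h′²_{□₀}]G′_{□₀}Q′\* and L_□ = Q′G′²_□Q′\* composed through the two lattices ([4] (2.52)/(2.55)), kernel-checked on 𝔅 (B9 pp. 393, 397, 411–412)

T. Bałaban, *Propagators for lattice gauge theories in a background field*, Commun. Math. Phys. **99**, 389–434
(1985) [Balaban1985BackgroundPropagators] (cell paper B9; PDF held `paper:balaban1985-cmp99-background-propagators`,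
journal page = PDF page + 388), with its template [4] = T. Bałaban, *Propagators and renormalization transformations
for lattice gauge theories. II*, Commun. Math. Phys. **96**, 223–250 (1984) [Balaban1984PropagatorsII] (journal
page = PDF page + 222).  Sibling of `…Balaban1983to89.B9Eq395Small` (UNTOUCHED; gen 6 of this cell), whose
`smallFactor_term_majorant` / `thirdSum_term_majorant` (and gen 5's `B9Thm39Sum.firstSum_term_majorant`) take the
COARSE-LEVEL majorants of A = Q′[G′_{□₀}, h′²_{□₀}]G′_{□₀}Q′\* (hypothesis `hA` : A ≺ θ(P y)⁻¹e^{−a_Aδ₀d}) and of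
L_□ = Q′G′²_□Q′\* (hypothesis `hL` : L_□ ≺ κ(P y)⁻¹e^{−a_Lδ₀d}) as INPUTS and record as NOT REPRODUCED (its header,
items (ii) and (v)) *"the composition of the coarse-level majorant of Q′[G′_{□₀}, h′²]G′_{□₀}Q′\* from the block-level
one of [G′_{□₀}, h′²] with those of Q′, G′_{□₀}, Q′\* — the generic (2.52)/(2.55) composition of [4] through two
lattices (unit pv21's `B6RandomWalkHom.hasMajorantHom_comp`, not imported)"*.  THIS MODULE IMPORTS IT AND DOES THAT
COMPOSITION: `hA` and `hL` become CONSEQUENCES of per-operator majorants of the printed shapes — Q′ and Q′\*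
block-diagonal ((3.18)–(3.19)), G′ of the (3.42)₁ shape — with every constant named (unit pv21's two-space majorants
`B6RandomWalkHom.HasMajorantHom`, `hasMajorantHom_comp`, `hasMajorantHom_iff`, pv08's `B6RandomWalk.hasMajorant_mul`,
gen 6's `B9Eq395Small.hasMajorant_comm_mulOp_sq`, `lin_mul_exp_le`, all read through `B9Thm34Ext.toB6`).

CITATION HEADER (lean-in-tree rule 2026-08-18).  This module is a KERNEL-CHECKED BOOKKEEPING STEP of the published
paper [Balaban1985BackgroundPropagators], p. 412 [PDF 24], verbatim: *"We move this function to the left, i.e. we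
write this expression as □̃Q′[G′_{□₀}, h′²_{□₀}]G′_{□₀}Q′\*h_□C_□h_□ + □̃Q′G′²_{□₀}Q′\*h_□C_□h_□. The commutator in the
first term gives O(M⁻¹). We consider this term as one factor in the random walk expansion."* and p. 411 [PDF 23]:
*"… + Σ_□[□̃Q′G′²_□Q′\*, h_□]C_□h_□ = I − R (3.95) By the same estimates as in [4], especially (2.83)–(2.85), we can see
that the operator R is small"*; composed from the printed SHAPES of

(p. 393 [PDF 5], the averaging operators; Q′\* their adjoint, (3.24)–(3.25) p. 394) *"(Q′λ)(y) = (Q′_j(U)λ)(y) for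
y ∈ Λ_j, (3.18) … (Q′_j(U)λ)(y) = (Q′(Ū^{j−1})·…·Q′(Ū)Q′(U)λ)(y) = Σ_{x∈B^j(y)} L^{−jd}R(U(Γ^{(j)}_{y,x}))λ(x),
y ∈ T^{(j)}_{L^jη}. (3.19)"* — (Q′λ)(y) depends on λ|_{B^j(y)} only: the BLOCK-DIAGONAL majorant shape c_Q·1_{y=y′}
between the fine lattice and 𝔅 (hypotheses `hQ`, `hQs` below; the constants c_Q, c_{Q\*} are parameters and NOTHING
about (3.19) is derived here);

(p. 397 [PDF 9], Theorem 3.1) *"|(G′(U)λ)(x)|, |(∇_UG′(U)λ)(x)|, |(G′(U)∇\*_Uλ)(x)|, |(Δ_UG′(U)λ)(x)| ≦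
B₀[(L^jη)², L^jη, L^jη, 1]e^{−δ₀d(y,y′)}|λ| for x ∈ Δ(y), y ∈ Λ_j, supp λ ⊂ Δ(y′); (3.42)"* (first entry) — the shape
B_G·P_G(y)·e^{−a_Gδ₀d(y,y′)} of hypothesis `hG` (P_G(y) for (L^jη)², a_G for the rate; (3.42) is gen 1's printed Prop
`B9.Ineq342_346_347` of Theorem 3.1, extended by Theorem 3.4 p. 400 / Corollary 3.5 p. 407 — NONE invoked: the
majorants of the propagators G′_{□₀}, G′_□ of the auxiliary domains of pp. 411–412 are hypotheses);

and of the template [4] = [Balaban1984PropagatorsII] p. 232 [PDF 10], verbatim: *"|(Rλ)(x)| ≦ O(M⁻¹)e^{−δ₀d(x,y)}|λ|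
if supp λ ⊂ B^j(y), y ∈ Λ_j. (2.51) … this property is preserved under the composition of operators possessing it.
A summation preserves it also"*, *"|(Rλ)(x)| ≦ O(1)ⁿ Σ_{y₁,…,y_{n−1}∈𝔅} e^{−δ₀d(y,y₁)}e^{−δ₀d(y₁,y₂)}·…·
e^{−δ₀d(y_{n−1},y′)}|λ|. (2.55)"*, and p. 237 [PDF 15], (2.83) lines 1–2, where the kernel of Q′G′²Q′\* enters the
estimate of R through *"≦ O(1)(L^jη)⁴ Σ_{y″∈supp h_□′} e^{−½δ₀d(y,y″)} c₁(L^{j′}η)^{−d−4}e^{−δ₁(L^{j′}η)^{−1}|y″−y′|}"* —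
i.e. the bound |(L^jη)^d(Q′G′²Q′\*)(y, y″)| ≦ O(1)(L^jη)⁴e^{−½δ₀d(y,y″)}, the shape κ·P_G(y)²·e^{−ρδ₀d(y,y″)} DERIVED
below (`lloc_majorant`): a part of the rate of G′ pays for the y″-sums of (2.52).

SETTING.  As in the siblings: 𝔅 = `g.Site` FINITE with decidable equality; the FINE lattice is an arbitrary type X
with block map `blk : X → g.Site` (x ↦ y with x ∈ B^j(y), [4] p. 231), operators on its functions are
`Module.End ℝ (X → ℝ)` (G′_{□₀}, G′_□, the multiplier h′_{□₀} = `B9Thm37Sum.mulOp hp`); the COARSE lattice is 𝔅 itself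
(block map the identity; majorants there = entrywise kernel bounds, gen 3's `B9Thm34Inv.hasMajorant_id_iff`); Q′ is a
linear map `(X → ℝ) →ₗ[ℝ] (g.Site → ℝ)` and Q′\* a linear map `(g.Site → ℝ) →ₗ[ℝ] (X → ℝ)` with TWO-SPACE majorants
(unit pv21's `B6RandomWalkHom.HasMajorantHom`), all read through `B9Thm34Ext.toB6`.  P_G ≧ 0 is any weight with the
scale-transfer property of the p. 398 remark at rate α_st with constant C (`B9Ineq347.ScaleTransfer`, [4] (2.60));
P > 0 is the weight of (3.48) for C_□ (P(y) for (L^jη)^{−4}), linked to P_G by the hypothesis `hPP` : P_G(y)² ≦ P(y)⁻¹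
(an equality for the printed weights).

WHAT IS REPRODUCED (0 sorry; every O(·) a NAMED constant; every hypothesis of the printed shape, NAMED, none cited):
* §0 `conv_kernel_le` — the y″-sum of [4] (2.52)/(2.63) with a weight in the middle, as a real inequality:
  Σ_{y″} e^{−a₁δ₀d(y,y″)}P_G(y″)e^{−bδ₀d(y″,y′)} ≦ C·P_G(y)·c₁(δ₀, b−ρ)·e^{−ρδ₀d(y,y′)} for a₁ ≧ α_st + ρ (scale transfer
  at α_st, triangle inequality (2.54), symmetry, (2.61) of [4] at b − ρ) — the computation inside gen 6's
  `conv_majorant`.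
* §1 `gg_majorant` — *"preserved under the composition"* for two operators of the (3.42)₁ shape on the fine lattice:
  G₁ ≺ B₁P_G(y)e^{−a₁δ₀d}, G₂ ≺ B₂P_G(y)e^{−a₂δ₀d} ⟹ G₁G₂ ≺ B₁B₂C·c₁(δ₀, a₂−ρ)·P_G(y)²·e^{−ρδ₀d} (a₁ ≧ α_st + ρ; pv08's
  `hasMajorant_mul` + §0).
* §2 `diag_sum_right`, `diag_sum_left`, `sandwich_majorant` — **the passage fine lattice ↦ 𝔅**: if Q′ ≺ c_Q·1_{y=y′}
  (fine → coarse) and Q′\* ≺ c_{Q\*}·1_{y=y′} (coarse → fine) in the two-space sense (c_{Q\*} ≧ 0) and M ≺ K ≧ 0 on the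
  fine lattice, then Q′MQ′\* ≺ c_Qc_{Q\*}·K on 𝔅 (pv21's `hasMajorantHom_comp` twice: the diagonal majorants collapse the
  y″-sums of (2.52)).
* §3 `lloc_majorant` — **the hypothesis `hL` of gen 5/6 DISCHARGED modulo per-operator inputs**: L_□ = Q′G′_□G′_□Q′\* ≺
  κ_L(P y)⁻¹e^{−ρδ₀d(y,y″)} with **κ_L = c_Qc_{Q\*}B_G²C·c₁(δ₀, a_G−ρ)** (a_G ≧ α_st + ρ) — the (2.83)-line-2 shape.
* §4 `commFactor_majorant`, `commFactor_hA` — **the hypothesis `hA` of gen 6 DISCHARGED modulo per-operator inputs**: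
  with h′_{□₀} (ℓ₀, ℓ₁)-slowly varying in d on the fine lattice and |h′| ≦ 1 (gen 6's `hasMajorant_comm_mulOp_sq`:
  [G′_{□₀}, h′²] ≺ (2ℓ₀ + 2ℓ₁d)·B_GP_Ge^{−a_Gδ₀d}; `lin_mul_exp_le`: a part α_c of the rate pays for the linear growth),
  A = Q′[G′_{□₀}, h′²_{□₀}]G′_{□₀}Q′\* ≺ θ_A(P y)⁻¹e^{−ρδ₀d(y,y″)} with
  **θ_A = c_Qc_{Q\*}(2ℓ₀ + 2ℓ₁(α_cδ₀)⁻¹)B_G²C·c₁(δ₀, a_G−ρ)** (a_G ≧ α_st + α_c + ρ) — for ℓ₀, ℓ₁ = O(M⁻¹) this IS the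
  printed *"The commutator in the first term gives O(M⁻¹)"* with its constant named; `p412_term_eq` +
  `p412_commTerm_majorant` — the first term of the p. 412 regrouping (gen 6's `regroup_412`), □̃·A·h_□C_□h_□, chained
  with gen 6's `smallFactor_term_majorant`: majorant 1_{S_□}(y′)·θ_AB₀C′c₁(δ₀, b−ρ′)·e^{−ρ′δ₀d(y,y′)} (ρ ≧ α′_st + ρ′).
* §5 `thirdSum_term_majorant_of_ops` — gen 6's third-sum □-term (□̃L_□h_□ − h_□□̃L_□)C_□h_□ with `hL` SUPPLIED by §3:
  majorant 1_{S_□}(y′)·(ℓ₀ + ℓ₁(α_cδ₀)⁻¹)κ_LB₀C′c₁(δ₀, b−ρ′)·e^{−ρ′δ₀d(y,y′)}.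

WHAT IS NOT REPRODUCED (located, not claimed): (i) the per-operator inputs themselves — the block-diagonal two-space
majorants of Q′, Q′\* (`hQ`, `hQs`; from (3.18)–(3.19) and the adjoint w.r.t. the scalar products of pp. 393–394:
NOT derived), the (3.42)₁-shape majorants of G′_{□₀}, G′_□ (`hG`; Theorem 3.4 / Corollary 3.5 for the auxiliary
domains — gen 1/2's named statements are not invoked), (3.48) for C_□ (`hCl`); (ii) the slow variation of h′_{□₀}
(on the fine lattice) and of h_□ (on 𝔅) in the multiscale distance d (`hLip`; ℓ₀, ℓ₁ = O(M⁻¹) from gradient bounds of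
the partitions of unity and the comparison of d with the scaled euclidean distance; cell GAPS G-pv08-1); (iii) (2.60),
(2.61) of [4] for THIS geometry and the metric facts of d (`hST`, `h261`, `htri`, `hsymm`, `hdnn`); (iv) the
[2]-difference estimate behind (3.97) (gen 6's `hD`; cell GAPS G-B9-05) — untouched; (v) the 𝒟′ re-expansion
combinatorics of pp. 411–412 and the final norm bound on R ((2.84)–(2.85) of [4] summed over □, □′) — prose / gen 5's
`localizedSum`-type lemmas.  NOTHING of the paper's end-statement is asserted; value = kernel-checked bookkeeping (the
two-lattice composition the print calls *"preserved under the composition of operators possessing it"*), with the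
constants the print leaves as O(·) made explicit — NOT summit progress.  Unit `b2b-balaban-b09-g6` (paper sub-cell
B09, gen 6), SHARPEN pass 4 of node T06.9 (G-B9-24 (iii), two-space composition); cell rows C-B9-25, census D-b09.16.
-/

namespace Literature.MathematicalPhysics.QuantumFieldTheory.Balaban1983to89.B9Eq395Hom

open Literature.MathematicalPhysics.QuantumFieldTheory.Balaban1983to89
open Finset B9Thm37Sum

/-! ## §0  The y″-sum of [4] (2.52)/(2.63) with a weight in the middle -/

section ConvKernel

variable {g : B9.Geometry} [Fintype g.Site] {R : ℝ} {H : Prop}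

/-- **The y″-sum of [4] (2.52) with a weight P_G(y″) in the middle** (the computation inside gen 6's `conv_majorant`,
as a real inequality): if e^{−α_stδ₀d(y,y″)}P_G(y″) ≦ C·P_G(y) (scale transfer, [4] (2.60) / B9 p. 398), d satisfies
the triangle inequality (2.54) and is symmetric and ≧ 0, and Σ_{y′}e^{−(b−ρ)δ₀d(y,y′)} ≦ c₁(δ₀, b−ρ) ((2.61)), then for
a₁ ≧ α_st + ρ, ρ ≧ 0:  Σ_{y″} e^{−a₁δ₀d(y,y″)}·P_G(y″)e^{−bδ₀d(y″,y′)} ≦ C·P_G(y)·c₁(δ₀, b−ρ)·e^{−ρδ₀d(y,y′)}.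
[cite: Balaban1984PropagatorsII, (2.52)–(2.55) p.232 + (2.60)–(2.63) p.233] -/
theorem conv_kernel_le (d : ℕ) (δ₀ a₁ αst ρ b C : ℝ) (PG : g.Site → ℝ)
    (hC : 0 ≤ C) (hPG : ∀ y, 0 ≤ PG y) (hδ₀ : 0 ≤ δ₀) (hρ : 0 ≤ ρ) (hsplit : αst + ρ ≤ a₁)
    (htri : B6RandomWalk.Triangle254 (B9Thm34Ext.toB6 g R H)) (hsymm : ∀ a b : g.Site, g.dist a b = g.dist b a)
    (hdnn : ∀ a b : g.Site, 0 ≤ g.dist a b)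
    (hST : B9Ineq347.ScaleTransfer g δ₀ αst C PG)
    (h261 : B6RandomWalk.Ineq261 d (B9Thm34Ext.toB6 g R H) δ₀ (b - ρ)) (a b' : g.Site) :
    ∑ y'' : g.Site, Real.exp (-(a₁ * δ₀ * g.dist a y'')) * (PG y'' * Real.exp (-(b * δ₀ * g.dist y'' b'))) ≤
      C * PG a * B6.c1 d δ₀ (b - ρ) * Real.exp (-(ρ * δ₀ * g.dist a b')) := by
  have hcoefρ : 0 ≤ ρ * δ₀ := mul_nonneg hρ hδ₀
  have hterm : ∀ y'' : g.Site,
      Real.exp (-(a₁ * δ₀ * g.dist a y'')) * (PG y'' * Real.exp (-(b * δ₀ * g.dist y'' b'))) ≤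
        C * PG a * Real.exp (-(ρ * δ₀ * g.dist a b')) * Real.exp (-((b - ρ) * δ₀ * g.dist b' y'')) := by
    intro y''
    -- (i) split of the first exponential: a₁ ≧ α_st + ρ
    have hsplitexp : Real.exp (-(a₁ * δ₀ * g.dist a y'')) ≤
        Real.exp (-(αst * δ₀ * g.dist a y'')) * Real.exp (-(ρ * δ₀ * g.dist a y'')) := by
      rw [← Real.exp_add]
      refine Real.exp_le_exp.mpr ?_
      have h1 := mul_le_mul_of_nonneg_right hsplit (mul_nonneg hδ₀ (hdnn a y''))
      nlinarith [h1]
    -- (ii) scale transfer e^{−α_stδ₀d(y,y″)}P_G(y″) ≦ C·P_G(y)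
    have hst : Real.exp (-(αst * δ₀ * g.dist a y'')) * PG y'' ≤ C * PG a := hST a y''
    -- (iii) triangle inequality and symmetry
    have htri' : Real.exp (-(ρ * δ₀ * g.dist a y'')) * Real.exp (-(b * δ₀ * g.dist y'' b')) ≤
        Real.exp (-(ρ * δ₀ * g.dist a b')) * Real.exp (-((b - ρ) * δ₀ * g.dist b' y'')) := by
      rw [← Real.exp_add, ← Real.exp_add]
      refine Real.exp_le_exp.mpr ?_
      have h0 : g.dist a b' ≤ g.dist a y'' + g.dist y'' b' := htri a y'' b'
      have h1 := mul_le_mul_of_nonneg_left h0 hcoefρ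
      rw [hsymm b' y'']
      nlinarith [h1]
    have hrest : 0 ≤ PG y'' * Real.exp (-(b * δ₀ * g.dist y'' b')) := mul_nonneg (hPG y'') (Real.exp_nonneg _)
    calc Real.exp (-(a₁ * δ₀ * g.dist a y'')) * (PG y'' * Real.exp (-(b * δ₀ * g.dist y'' b')))
        ≤ Real.exp (-(αst * δ₀ * g.dist a y'')) * Real.exp (-(ρ * δ₀ * g.dist a y'')) *
            (PG y'' * Real.exp (-(b * δ₀ * g.dist y'' b'))) := mul_le_mul_of_nonneg_right hsplitexp hrest
      _ = (Real.exp (-(αst * δ₀ * g.dist a y'')) * PG y'') *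
            (Real.exp (-(ρ * δ₀ * g.dist a y'')) * Real.exp (-(b * δ₀ * g.dist y'' b'))) := by ring
      _ ≤ (C * PG a) * (Real.exp (-(ρ * δ₀ * g.dist a b')) * Real.exp (-((b - ρ) * δ₀ * g.dist b' y''))) :=
          mul_le_mul hst htri' (mul_nonneg (Real.exp_nonneg _) (Real.exp_nonneg _)) (mul_nonneg hC (hPG a))
      _ = _ := by ring
  have hpref : 0 ≤ C * PG a * Real.exp (-(ρ * δ₀ * g.dist a b')) :=
    mul_nonneg (mul_nonneg hC (hPG a)) (Real.exp_nonneg _)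
  calc ∑ y'' : g.Site, Real.exp (-(a₁ * δ₀ * g.dist a y'')) * (PG y'' * Real.exp (-(b * δ₀ * g.dist y'' b')))
      ≤ ∑ y'' : g.Site, C * PG a * Real.exp (-(ρ * δ₀ * g.dist a b')) *
          Real.exp (-((b - ρ) * δ₀ * g.dist b' y'')) := Finset.sum_le_sum fun y'' _ => hterm y''
    _ = C * PG a * Real.exp (-(ρ * δ₀ * g.dist a b')) *
          ∑ y'' : g.Site, Real.exp (-((b - ρ) * δ₀ * g.dist b' y'')) := by rw [Finset.mul_sum]
    _ ≤ C * PG a * Real.exp (-(ρ * δ₀ * g.dist a b')) * B6.c1 d δ₀ (b - ρ) :=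
        mul_le_mul_of_nonneg_left (h261 b') hpref
    _ = _ := by ring

end ConvKernel

/-! ## §1  "preserved under the composition": two operators of the (3.42)₁ shape on the fine lattice -/

section TwoLattice

variable {g : B9.Geometry} [Fintype g.Site] [DecidableEq g.Site] {R : ℝ} {H : Prop} {X : Type}

omit [DecidableEq g.Site] in
/-- **G₁G₂ for two operators of the (3.42)₁ shape** (*"this property is preserved under the composition of operators
possessing it"*, [4] p. 232; the instance behind G′²_□ and [G′_{□₀}, h′²]G′_{□₀}): if G₁ ≺ B₁P_G(y)e^{−a₁δ₀d(y,y″)} and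
G₂ ≺ B₂P_G(y″)e^{−a₂δ₀d(y″,y′)} on the fine lattice (block map `blk`), P_G ≧ 0 with scale transfer at α_st (constant
C), a₁ ≧ α_st + ρ, (2.61) at a₂ − ρ, then G₁G₂ ≺ B₁B₂C·c₁(δ₀, a₂−ρ)·P_G(y)²·e^{−ρδ₀d(y,y′)} (pv08's `hasMajorant_mul`, the
y″-sum by `conv_kernel_le`). [cite: Balaban1984PropagatorsII, (2.52)–(2.55) p.232; Balaban1985BackgroundPropagators, (3.42) p.397] -/
theorem gg_majorant (blk : X → g.Site) (d : ℕ) (δ₀ a₁ a₂ αst ρ B₁ B₂ C : ℝ) (PG : g.Site → ℝ)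
    (hB₁ : 0 ≤ B₁) (hB₂ : 0 ≤ B₂) (hC : 0 ≤ C) (hPG : ∀ y, 0 ≤ PG y) (hδ₀ : 0 ≤ δ₀) (hρ : 0 ≤ ρ)
    (hsplit : αst + ρ ≤ a₁)
    (htri : B6RandomWalk.Triangle254 (B9Thm34Ext.toB6 g R H)) (hsymm : ∀ a b : g.Site, g.dist a b = g.dist b a)
    (hdnn : ∀ a b : g.Site, 0 ≤ g.dist a b)
    (hST : B9Ineq347.ScaleTransfer g δ₀ αst C PG)
    (h261 : B6RandomWalk.Ineq261 d (B9Thm34Ext.toB6 g R H) δ₀ (a₂ - ρ))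
    {G₁ G₂ : Module.End ℝ (X → ℝ)}
    (h₁ : B6RandomWalk.HasMajorant (g := B9Thm34Ext.toB6 g R H) blk G₁
      (fun (a y'' : g.Site) => B₁ * PG a * Real.exp (-(a₁ * δ₀ * g.dist a y''))))
    (h₂ : B6RandomWalk.HasMajorant (g := B9Thm34Ext.toB6 g R H) blk G₂
      (fun (y'' b' : g.Site) => B₂ * PG y'' * Real.exp (-(a₂ * δ₀ * g.dist y'' b')))) :
    B6RandomWalk.HasMajorant (g := B9Thm34Ext.toB6 g R H) blk (G₁ * G₂)
      (fun (a b' : g.Site) => B₁ * B₂ * C * B6.c1 d δ₀ (a₂ - ρ) * PG a ^ 2 *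
        Real.exp (-(ρ * δ₀ * g.dist a b'))) := by
  have hK₂ : ∀ y'' b' : g.Site, 0 ≤ B₂ * PG y'' * Real.exp (-(a₂ * δ₀ * g.dist y'' b')) := fun y'' b' =>
    mul_nonneg (mul_nonneg hB₂ (hPG y'')) (Real.exp_nonneg _)
  have h12 := B6RandomWalk.hasMajorant_mul (g := B9Thm34Ext.toB6 g R H) _ h₁ h₂ hK₂
  refine B6RandomWalk.hasMajorant_mono (g := B9Thm34Ext.toB6 g R H) _ h12 fun (a b' : g.Site) => ?_
  have hsum := conv_kernel_le (R := R) (H := H) d δ₀ a₁ αst ρ a₂ C PG hC hPG hδ₀ hρ hsplit htri hsymm hdnn hST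
    h261 a b'
  have hc : 0 ≤ B₁ * B₂ * PG a := mul_nonneg (mul_nonneg hB₁ hB₂) (hPG a)
  calc ∑ y'' : g.Site, B₁ * PG a * Real.exp (-(a₁ * δ₀ * g.dist a y'')) *
          (B₂ * PG y'' * Real.exp (-(a₂ * δ₀ * g.dist y'' b')))
      = B₁ * B₂ * PG a * ∑ y'' : g.Site, Real.exp (-(a₁ * δ₀ * g.dist a y'')) *
          (PG y'' * Real.exp (-(a₂ * δ₀ * g.dist y'' b'))) := by
        rw [Finset.mul_sum]
        exact Finset.sum_congr rfl fun y'' _ => by ring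
    _ ≤ B₁ * B₂ * PG a * (C * PG a * B6.c1 d δ₀ (a₂ - ρ) * Real.exp (-(ρ * δ₀ * g.dist a b'))) :=
        mul_le_mul_of_nonneg_left hsum hc
    _ = _ := by ring

/-! ## §2  The passage fine lattice ↦ 𝔅: Q′·M·Q′\* with block-diagonal Q′, Q′\* -/

/-- A y″-sum against a DIAGONAL majorant on the right collapses: Σ_{y″}K(y,y″)·c1_{y″=y′} = c·K(y,y′). [folklore] -/
theorem diag_sum_right (K : g.Site → g.Site → ℝ) (c : ℝ) (a b : g.Site) :
    (∑ y'' : g.Site, K a y'' * (c * (if y'' = b then (1 : ℝ) else 0))) = c * K a b := by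
  rw [Finset.sum_eq_single b]
  · rw [if_pos rfl]
    ring
  · intro y'' _ hne
    rw [if_neg hne]
    ring
  · intro h
    exact absurd (Finset.mem_univ b) h

/-- A y″-sum against a DIAGONAL majorant on the left collapses: Σ_{y″}c1_{y=y″}·K(y″,y′) = c·K(y,y′). [folklore] -/
theorem diag_sum_left (K : g.Site → g.Site → ℝ) (c : ℝ) (a b : g.Site) :
    (∑ y'' : g.Site, c * (if a = y'' then (1 : ℝ) else 0) * K y'' b) = c * K a b := by
  rw [Finset.sum_eq_single a]
  · rw [if_pos rfl]
    ring
  · intro y'' _ hne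
    rw [if_neg (fun h => hne h.symm)]
    ring
  · intro h
    exact absurd (Finset.mem_univ a) h

/-- **Q′MQ′\* on 𝔅 from M on the fine lattice** ([4] (2.52) through the two lattices, pv21's `hasMajorantHom_comp`
twice): if Q′ : (fine functions) → (functions on 𝔅) has the two-space majorant c_Q·1_{y=y′} ((Q′λ)(y) depends on
λ|_{B(y)} only and |(Q′λ)(y)| ≦ c_Q sup|λ| — the shape of (3.19); HYPOTHESIS `hQ`), Q′\* : (functions on 𝔅) → (fine
functions) the two-space majorant c_{Q\*}·1_{y=y′} with c_{Q\*} ≧ 0 (HYPOTHESIS `hQs`), and M ≺ K ≧ 0 (block map `blk`),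
then Q′MQ′\* has the entrywise majorant c_Qc_{Q\*}·K(y, y′) on 𝔅 — the diagonal majorants collapse both y″-sums.
[cite: Balaban1984PropagatorsII, (2.52)–(2.55) p.232; Balaban1985BackgroundPropagators, (3.18)–(3.19) p.393] -/
theorem sandwich_majorant (blk : X → g.Site) (cQ cQs : ℝ) (hcQs : 0 ≤ cQs)
    {Qp : (X → ℝ) →ₗ[ℝ] (g.Site → ℝ)} {Qs : (g.Site → ℝ) →ₗ[ℝ] (X → ℝ)} {Mf : Module.End ℝ (X → ℝ)}
    {K : g.Site → g.Site → ℝ} (hK : ∀ a b, 0 ≤ K a b)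
    (hQ : B6RandomWalkHom.HasMajorantHom (g := B9Thm34Ext.toB6 g R H) blk (fun y : g.Site => y) Qp
      (fun (a b : g.Site) => cQ * (if a = b then (1 : ℝ) else 0)))
    (hQs : B6RandomWalkHom.HasMajorantHom (g := B9Thm34Ext.toB6 g R H) (fun y : g.Site => y) blk Qs
      (fun (a b : g.Site) => cQs * (if a = b then (1 : ℝ) else 0)))
    (hM : B6RandomWalk.HasMajorant (g := B9Thm34Ext.toB6 g R H) blk Mf K) :
    B6RandomWalk.HasMajorant (g := B9Thm34Ext.toB6 g R H) (fun y : g.Site => y) (Qp ∘ₗ Mf ∘ₗ Qs)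
      (fun (a b : g.Site) => cQ * cQs * K a b) := by
  -- M as a two-space operator fine → fine
  have hMh : B6RandomWalkHom.HasMajorantHom (g := B9Thm34Ext.toB6 g R H) blk blk Mf K :=
    (B6RandomWalkHom.hasMajorantHom_iff (g := B9Thm34Ext.toB6 g R H) blk Mf K).mpr hM
  have hδ : ∀ a b : g.Site, 0 ≤ cQs * (if a = b then (1 : ℝ) else 0) := fun a b =>
    mul_nonneg hcQs (by split_ifs <;> norm_num)
  -- MQ′\* : (functions on 𝔅) → (fine functions), majorant Σ_{y″}K(y,y″)c_{Q*}1_{y″=y′} = c_{Q*}K(y,y′)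
  have hMQs : B6RandomWalkHom.HasMajorantHom (g := B9Thm34Ext.toB6 g R H) (fun y : g.Site => y) blk (Mf ∘ₗ Qs)
      (fun (a b : g.Site) => cQs * K a b) := by
    have h := B6RandomWalkHom.hasMajorantHom_comp (g := B9Thm34Ext.toB6 g R H) (fun y : g.Site => y) blk blk
      hMh hQs hδ
    refine B6RandomWalkHom.hasMajorantHom_mono (g := B9Thm34Ext.toB6 g R H) _ _ h fun (a b : g.Site) => ?_
    exact (diag_sum_right K cQs a b).le
  have hK' : ∀ a b : g.Site, 0 ≤ cQs * K a b := fun a b => mul_nonneg hcQs (hK a b)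
  -- Q′(MQ′\*) : (functions on 𝔅) → (functions on 𝔅), majorant Σ_{y″}c_Q1_{y=y″}·c_{Q*}K(y″,y′) = c_Qc_{Q*}K(y,y′)
  have h2 := B6RandomWalkHom.hasMajorantHom_comp (g := B9Thm34Ext.toB6 g R H) (fun y : g.Site => y) blk
    (fun y : g.Site => y) hQ hMQs hK'
  refine (B6RandomWalkHom.hasMajorantHom_iff (g := B9Thm34Ext.toB6 g R H) (fun y : g.Site => y) _ _).mp ?_
  refine B6RandomWalkHom.hasMajorantHom_mono (g := B9Thm34Ext.toB6 g R H) _ _ h2 fun (a b : g.Site) => ?_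
  calc ∑ y'' : g.Site, cQ * (if a = y'' then (1 : ℝ) else 0) * (cQs * K y'' b)
      = cQ * (cQs * K a b) := diag_sum_left (fun (y'' b : g.Site) => cQs * K y'' b) cQ a b
    _ = cQ * cQs * K a b := by ring
    _ ≤ cQ * cQs * K a b := le_rfl

/-! ## §3  L_□ = Q′G′²_□Q′\*: the hypothesis `hL` of gen 5/6 from per-operator majorants -/

/-- **L_□ = Q′G′_□G′_□Q′\* has the majorant κ_L(P y)⁻¹e^{−ρδ₀d(y,y″)}** with κ_L = c_Qc_{Q\*}B_G²C·c₁(δ₀, a_G−ρ) — the shape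
of the hypothesis `hL` of `B9Thm39Sum.firstSum_term_majorant` / `B9Eq395Small.thirdSum_term_majorant` ((2.83) line 2
of [4]: *"≦ O(1)(L^jη)⁴ Σ_{y″} e^{−½δ₀d(y,y″)} …"*), DERIVED from: G′_□ ≺ B_GP_G(y)e^{−a_Gδ₀d} on the fine lattice
((3.42)₁ shape, HYPOTHESIS `hG`), Q′ ≺ c_Q1_{y=y′}, Q′\* ≺ c_{Q\*}1_{y=y′} (HYPOTHESES `hQ`, `hQs`), P_G ≧ 0 with scale
transfer at α_st, a_G ≧ α_st + ρ, (2.61) at a_G − ρ, (2.54), and the weight link P_G(y)² ≦ P(y)⁻¹ (`hPP`).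
[cite: Balaban1985BackgroundPropagators, (3.95) p.411 + (3.42) p.397; Balaban1984PropagatorsII, (2.83) p.237] -/
theorem lloc_majorant (blk : X → g.Site) (d : ℕ) (δ₀ aG αst ρ BG C cQ cQs : ℝ) (PG P : g.Site → ℝ)
    (hBG : 0 ≤ BG) (hC : 0 ≤ C) (hcQ : 0 ≤ cQ) (hcQs : 0 ≤ cQs) (hPG : ∀ y, 0 ≤ PG y) (hδ₀ : 0 ≤ δ₀)
    (hρ : 0 ≤ ρ) (hsplit : αst + ρ ≤ aG)
    (htri : B6RandomWalk.Triangle254 (B9Thm34Ext.toB6 g R H)) (hsymm : ∀ a b : g.Site, g.dist a b = g.dist b a)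
    (hdnn : ∀ a b : g.Site, 0 ≤ g.dist a b)
    (hST : B9Ineq347.ScaleTransfer g δ₀ αst C PG)
    (h261 : B6RandomWalk.Ineq261 d (B9Thm34Ext.toB6 g R H) δ₀ (aG - ρ))
    (hPP : ∀ y, PG y ^ 2 ≤ (P y)⁻¹)
    {Qp : (X → ℝ) →ₗ[ℝ] (g.Site → ℝ)} {Qs : (g.Site → ℝ) →ₗ[ℝ] (X → ℝ)} {Gf : Module.End ℝ (X → ℝ)}
    (hQ : B6RandomWalkHom.HasMajorantHom (g := B9Thm34Ext.toB6 g R H) blk (fun y : g.Site => y) Qp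
      (fun (a b : g.Site) => cQ * (if a = b then (1 : ℝ) else 0)))
    (hQs : B6RandomWalkHom.HasMajorantHom (g := B9Thm34Ext.toB6 g R H) (fun y : g.Site => y) blk Qs
      (fun (a b : g.Site) => cQs * (if a = b then (1 : ℝ) else 0)))
    (hG : B6RandomWalk.HasMajorant (g := B9Thm34Ext.toB6 g R H) blk Gf
      (fun (a b : g.Site) => BG * PG a * Real.exp (-(aG * δ₀ * g.dist a b)))) :
    B6RandomWalk.HasMajorant (g := B9Thm34Ext.toB6 g R H) (fun y : g.Site => y) (Qp ∘ₗ (Gf * Gf) ∘ₗ Qs)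
      (fun (a y'' : g.Site) => (cQ * cQs * BG * BG * C * B6.c1 d δ₀ (aG - ρ)) * (P a)⁻¹ *
        Real.exp (-(ρ * δ₀ * g.dist a y''))) := by
  have hgg := gg_majorant (R := R) (H := H) blk d δ₀ aG aG αst ρ BG BG C PG hBG hBG hC hPG hδ₀ hρ hsplit htri hsymm
    hdnn hST h261 hG hG
  have hK : ∀ a b : g.Site, 0 ≤ BG * BG * C * B6.c1 d δ₀ (aG - ρ) * PG a ^ 2 * Real.exp (-(ρ * δ₀ * g.dist a b)) :=
    fun a b => mul_nonneg (mul_nonneg (mul_nonneg (mul_nonneg (mul_nonneg hBG hBG) hC)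
      (B6RandomWalk.c1_nonneg d δ₀ (aG - ρ))) (sq_nonneg _)) (Real.exp_nonneg _)
  have hs := sandwich_majorant (R := R) (H := H) blk cQ cQs hcQs hK hQ hQs hgg
  refine B6RandomWalk.hasMajorant_mono (g := B9Thm34Ext.toB6 g R H) _ hs fun (a b : g.Site) => ?_
  have hc : 0 ≤ cQ * cQs * BG * BG * C * B6.c1 d δ₀ (aG - ρ) * Real.exp (-(ρ * δ₀ * g.dist a b)) :=
    mul_nonneg (mul_nonneg (mul_nonneg (mul_nonneg (mul_nonneg (mul_nonneg hcQ hcQs) hBG) hBG) hC)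
      (B6RandomWalk.c1_nonneg d δ₀ (aG - ρ))) (Real.exp_nonneg _)
  calc cQ * cQs * (BG * BG * C * B6.c1 d δ₀ (aG - ρ) * PG a ^ 2 * Real.exp (-(ρ * δ₀ * g.dist a b)))
      = (cQ * cQs * BG * BG * C * B6.c1 d δ₀ (aG - ρ) * Real.exp (-(ρ * δ₀ * g.dist a b))) * PG a ^ 2 := by ring
    _ ≤ (cQ * cQs * BG * BG * C * B6.c1 d δ₀ (aG - ρ) * Real.exp (-(ρ * δ₀ * g.dist a b))) * (P a)⁻¹ :=
        mul_le_mul_of_nonneg_left (hPP a) hc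
    _ = _ := by ring

/-! ## §4  "The commutator in the first term gives O(M⁻¹)": A = Q′[G′_{□₀}, h′²_{□₀}]G′_{□₀}Q′\* composed -/

/-- **The p. 412 factor composed through the two lattices**: with G′_{□₀} ≺ B_GP_G(y)e^{−a_Gδ₀d(y,y′)} on the fine
lattice (HYPOTHESIS `hG`, (3.42)₁ shape), h′_{□₀} a fine-lattice multiplier with |h′| ≦ 1 and |h′(x′) − h′(x)| ≦
ℓ₀ + ℓ₁d(y(x), y(x′)) (HYPOTHESIS `hLip`; ℓ₀, ℓ₁ = O(M⁻¹) is the content of "h′ varies on the scale ML^jη"), Q′, Q′\*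
block-diagonal (HYPOTHESES `hQ`, `hQs`), P_G ≧ 0 with scale transfer at α_st (constant C), α_cδ₀ > 0, ρ ≧ 0,
a_G ≧ α_st + α_c + ρ and (2.61) at a_G − ρ:  A = Q′(G′_{□₀}h′² − h′²G′_{□₀})G′_{□₀}Q′\* has the entrywise majorant
θ′·P_G(y)²·e^{−ρδ₀d(y,y″)} on 𝔅 with **θ′ = c_Qc_{Q\*}(2ℓ₀ + 2ℓ₁(α_cδ₀)⁻¹)B_G²C·c₁(δ₀, a_G−ρ)** (gen 6's
`hasMajorant_comm_mulOp_sq` and `lin_mul_exp_le`, then `gg_majorant`, then `sandwich_majorant`).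
[cite: Balaban1985BackgroundPropagators, p.412; Balaban1984PropagatorsII, (2.52)–(2.55) p.232 + p.238] -/
theorem commFactor_majorant (blk : X → g.Site) (d : ℕ) (δ₀ aG αc αst ρ ℓ₀ ℓ₁ BG C cQ cQs : ℝ) (PG : g.Site → ℝ)
    (hp : X → ℝ)
    (hℓ₀ : 0 ≤ ℓ₀) (hℓ₁ : 0 ≤ ℓ₁) (hBG : 0 ≤ BG) (hC : 0 ≤ C) (hcQs : 0 ≤ cQs) (hPG : ∀ y, 0 ≤ PG y)
    (hδ₀ : 0 ≤ δ₀) (hαc : 0 < αc * δ₀) (hρ : 0 ≤ ρ) (hsplit : αst + αc + ρ ≤ aG)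
    (htri : B6RandomWalk.Triangle254 (B9Thm34Ext.toB6 g R H)) (hsymm : ∀ a b : g.Site, g.dist a b = g.dist b a)
    (hdnn : ∀ a b : g.Site, 0 ≤ g.dist a b)
    (hST : B9Ineq347.ScaleTransfer g δ₀ αst C PG)
    (h261 : B6RandomWalk.Ineq261 d (B9Thm34Ext.toB6 g R H) δ₀ (aG - ρ))
    (hh1 : ∀ x, |hp x| ≤ 1) (hLip : ∀ x x' : X, |hp x' - hp x| ≤ ℓ₀ + ℓ₁ * g.dist (blk x) (blk x'))
    {Qp : (X → ℝ) →ₗ[ℝ] (g.Site → ℝ)} {Qs : (g.Site → ℝ) →ₗ[ℝ] (X → ℝ)} {Gf : Module.End ℝ (X → ℝ)}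
    (hQ : B6RandomWalkHom.HasMajorantHom (g := B9Thm34Ext.toB6 g R H) blk (fun y : g.Site => y) Qp
      (fun (a b : g.Site) => cQ * (if a = b then (1 : ℝ) else 0)))
    (hQs : B6RandomWalkHom.HasMajorantHom (g := B9Thm34Ext.toB6 g R H) (fun y : g.Site => y) blk Qs
      (fun (a b : g.Site) => cQs * (if a = b then (1 : ℝ) else 0)))
    (hG : B6RandomWalk.HasMajorant (g := B9Thm34Ext.toB6 g R H) blk Gf
      (fun (a b : g.Site) => BG * PG a * Real.exp (-(aG * δ₀ * g.dist a b)))) :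
    B6RandomWalk.HasMajorant (g := B9Thm34Ext.toB6 g R H) (fun y : g.Site => y)
      (Qp ∘ₗ ((Gf * (mulOp hp * mulOp hp) - (mulOp hp * mulOp hp) * Gf) * Gf) ∘ₗ Qs)
      (fun (a y'' : g.Site) => (cQ * cQs * (2 * ℓ₀ + 2 * ℓ₁ * (αc * δ₀)⁻¹) * BG * BG * C * B6.c1 d δ₀ (aG - ρ)) *
        PG a ^ 2 * Real.exp (-(ρ * δ₀ * g.dist a y''))) := by
  -- (i) [G′_{□₀}, h′²] ≺ (2ℓ₀ + 2ℓ₁d)·B_GP_Ge^{−a_Gδ₀d}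
  have hcomm := B9Eq395Small.hasMajorant_comm_mulOp_sq (G := B9Thm34Ext.toB6 g R H) blk hG hp ℓ₀ ℓ₁ hℓ₀ hℓ₁
    hdnn hh1 hLip
  -- (ii) the part α_c of the rate pays for the linear growth
  have hcomm' : B6RandomWalk.HasMajorant (g := B9Thm34Ext.toB6 g R H) blk
      (Gf * (mulOp hp * mulOp hp) - (mulOp hp * mulOp hp) * Gf)
      (fun (a y'' : g.Site) => ((2 * ℓ₀ + 2 * ℓ₁ * (αc * δ₀)⁻¹) * BG) * PG a *
        Real.exp (-((aG - αc) * δ₀ * g.dist a y''))) := by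
    refine B6RandomWalk.hasMajorant_mono (g := B9Thm34Ext.toB6 g R H) _ hcomm fun (a y'' : g.Site) => ?_
    have h1 := B9Eq395Small.lin_mul_exp_le (2 * ℓ₀) (2 * ℓ₁) aG αc δ₀ (g.dist a y'') (by linarith) (by linarith)
      hαc (hdnn a y'')
    have h2 : 0 ≤ BG * PG a := mul_nonneg hBG (hPG a)
    calc (2 * ℓ₀ + 2 * ℓ₁ * g.dist a y'') * (BG * PG a * Real.exp (-(aG * δ₀ * g.dist a y'')))
        = BG * PG a * ((2 * ℓ₀ + 2 * ℓ₁ * g.dist a y'') * Real.exp (-(aG * δ₀ * g.dist a y''))) := by ring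
      _ ≤ BG * PG a * ((2 * ℓ₀ + 2 * ℓ₁ * (αc * δ₀)⁻¹) * Real.exp (-((aG - αc) * δ₀ * g.dist a y''))) :=
          mul_le_mul_of_nonneg_left h1 h2
      _ = _ := by ring
  -- (iii) compose with G′_{□₀} on the fine lattice, (iv) sandwich between Q′ and Q′\*
  have hsplit' : αst + ρ ≤ aG - αc := by linarith
  have hℓ : 0 ≤ 2 * ℓ₀ + 2 * ℓ₁ * (αc * δ₀)⁻¹ :=
    add_nonneg (by linarith) (mul_nonneg (by linarith) (inv_nonneg.mpr hαc.le))
  have hB₁ : 0 ≤ (2 * ℓ₀ + 2 * ℓ₁ * (αc * δ₀)⁻¹) * BG := mul_nonneg hℓ hBG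
  have hgg := gg_majorant (R := R) (H := H) blk d δ₀ (aG - αc) aG αst ρ ((2 * ℓ₀ + 2 * ℓ₁ * (αc * δ₀)⁻¹) * BG)
    BG C PG hB₁ hBG hC hPG hδ₀ hρ hsplit' htri hsymm hdnn hST h261 hcomm' hG
  have hK : ∀ a b : g.Site, 0 ≤ (2 * ℓ₀ + 2 * ℓ₁ * (αc * δ₀)⁻¹) * BG * BG * C * B6.c1 d δ₀ (aG - ρ) * PG a ^ 2 *
      Real.exp (-(ρ * δ₀ * g.dist a b)) := fun a b =>
    mul_nonneg (mul_nonneg (mul_nonneg (mul_nonneg (mul_nonneg hB₁ hBG) hC)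
      (B6RandomWalk.c1_nonneg d δ₀ (aG - ρ))) (sq_nonneg _)) (Real.exp_nonneg _)
  have hs := sandwich_majorant (R := R) (H := H) blk cQ cQs hcQs hK hQ hQs hgg
  refine B6RandomWalk.hasMajorant_mono (g := B9Thm34Ext.toB6 g R H) _ hs fun (a b : g.Site) => le_of_eq ?_
  ring

/-- **`hA` of gen 6 supplied**: the same majorant in the (P y)⁻¹-form θ_A(P y)⁻¹e^{−ρδ₀d(y,y″)} expected by
`B9Eq395Small.smallFactor_term_majorant`, θ_A = c_Qc_{Q\*}(2ℓ₀ + 2ℓ₁(α_cδ₀)⁻¹)B_G²C·c₁(δ₀, a_G−ρ), through the weight link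
P_G(y)² ≦ P(y)⁻¹ (`hPP`; c_Q ≧ 0).  For ℓ₀ = m₀M⁻¹, ℓ₁ = m₁M⁻¹ this is the printed *"O(M⁻¹)"* of p. 412 with its constant
NAMED: θ_A = c_Qc_{Q\*}(2m₀ + 2m₁(α_cδ₀)⁻¹)B_G²Cc₁·M⁻¹. [cite: Balaban1985BackgroundPropagators, p.412] -/
theorem commFactor_hA (blk : X → g.Site) (d : ℕ) (δ₀ aG αc αst ρ ℓ₀ ℓ₁ BG C cQ cQs : ℝ) (PG P : g.Site → ℝ)
    (hp : X → ℝ)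
    (hℓ₀ : 0 ≤ ℓ₀) (hℓ₁ : 0 ≤ ℓ₁) (hBG : 0 ≤ BG) (hC : 0 ≤ C) (hcQ : 0 ≤ cQ) (hcQs : 0 ≤ cQs)
    (hPG : ∀ y, 0 ≤ PG y) (hδ₀ : 0 ≤ δ₀) (hαc : 0 < αc * δ₀) (hρ : 0 ≤ ρ) (hsplit : αst + αc + ρ ≤ aG)
    (htri : B6RandomWalk.Triangle254 (B9Thm34Ext.toB6 g R H)) (hsymm : ∀ a b : g.Site, g.dist a b = g.dist b a)
    (hdnn : ∀ a b : g.Site, 0 ≤ g.dist a b)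
    (hST : B9Ineq347.ScaleTransfer g δ₀ αst C PG)
    (h261 : B6RandomWalk.Ineq261 d (B9Thm34Ext.toB6 g R H) δ₀ (aG - ρ))
    (hPP : ∀ y, PG y ^ 2 ≤ (P y)⁻¹)
    (hh1 : ∀ x, |hp x| ≤ 1) (hLip : ∀ x x' : X, |hp x' - hp x| ≤ ℓ₀ + ℓ₁ * g.dist (blk x) (blk x'))
    {Qp : (X → ℝ) →ₗ[ℝ] (g.Site → ℝ)} {Qs : (g.Site → ℝ) →ₗ[ℝ] (X → ℝ)} {Gf : Module.End ℝ (X → ℝ)}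
    (hQ : B6RandomWalkHom.HasMajorantHom (g := B9Thm34Ext.toB6 g R H) blk (fun y : g.Site => y) Qp
      (fun (a b : g.Site) => cQ * (if a = b then (1 : ℝ) else 0)))
    (hQs : B6RandomWalkHom.HasMajorantHom (g := B9Thm34Ext.toB6 g R H) (fun y : g.Site => y) blk Qs
      (fun (a b : g.Site) => cQs * (if a = b then (1 : ℝ) else 0)))
    (hG : B6RandomWalk.HasMajorant (g := B9Thm34Ext.toB6 g R H) blk Gf
      (fun (a b : g.Site) => BG * PG a * Real.exp (-(aG * δ₀ * g.dist a b)))) :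
    B6RandomWalk.HasMajorant (g := B9Thm34Ext.toB6 g R H) (fun y : g.Site => y)
      (Qp ∘ₗ ((Gf * (mulOp hp * mulOp hp) - (mulOp hp * mulOp hp) * Gf) * Gf) ∘ₗ Qs)
      (fun (a y'' : g.Site) => (cQ * cQs * (2 * ℓ₀ + 2 * ℓ₁ * (αc * δ₀)⁻¹) * BG * BG * C * B6.c1 d δ₀ (aG - ρ)) *
        (P a)⁻¹ * Real.exp (-(ρ * δ₀ * g.dist a y''))) := by
  have h := commFactor_majorant (R := R) (H := H) blk d δ₀ aG αc αst ρ ℓ₀ ℓ₁ BG C cQ cQs PG hp hℓ₀ hℓ₁ hBG hC hcQs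
    hPG hδ₀ hαc hρ hsplit htri hsymm hdnn hST h261 hh1 hLip hQ hQs hG
  refine B6RandomWalk.hasMajorant_mono (g := B9Thm34Ext.toB6 g R H) _ h fun (a b : g.Site) => ?_
  have hℓ : 0 ≤ 2 * ℓ₀ + 2 * ℓ₁ * (αc * δ₀)⁻¹ :=
    add_nonneg (by linarith) (mul_nonneg (by linarith) (inv_nonneg.mpr hαc.le))
  have hc : 0 ≤ cQ * cQs * (2 * ℓ₀ + 2 * ℓ₁ * (αc * δ₀)⁻¹) * BG * BG * C * B6.c1 d δ₀ (aG - ρ) *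
      Real.exp (-(ρ * δ₀ * g.dist a b)) :=
    mul_nonneg (mul_nonneg (mul_nonneg (mul_nonneg (mul_nonneg (mul_nonneg (mul_nonneg hcQ hcQs) hℓ) hBG) hBG)
      hC) (B6RandomWalk.c1_nonneg d δ₀ (aG - ρ))) (Real.exp_nonneg _)
  calc (cQ * cQs * (2 * ℓ₀ + 2 * ℓ₁ * (αc * δ₀)⁻¹) * BG * BG * C * B6.c1 d δ₀ (aG - ρ)) * PG a ^ 2 *
          Real.exp (-(ρ * δ₀ * g.dist a b))
      = (cQ * cQs * (2 * ℓ₀ + 2 * ℓ₁ * (αc * δ₀)⁻¹) * BG * BG * C * B6.c1 d δ₀ (aG - ρ) *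
          Real.exp (-(ρ * δ₀ * g.dist a b))) * PG a ^ 2 := by ring
    _ ≤ (cQ * cQs * (2 * ℓ₀ + 2 * ℓ₁ * (αc * δ₀)⁻¹) * BG * BG * C * B6.c1 d δ₀ (aG - ρ) *
          Real.exp (-(ρ * δ₀ * g.dist a b))) * (P a)⁻¹ := mul_le_mul_of_nonneg_left (hPP a) hc
    _ = _ := by ring

/-- **The first term of the p. 412 regrouping as one factor**: □̃·A·h_□C_□h_□ with A = Q′[G′_{□₀}, h′²_{□₀}]G′_{□₀}Q′\* composed
as above (ρ the rate left on 𝔅) and C_□ ≺ B₀P(y)e^{−bδ₀d} ((3.48), HYPOTHESIS `hCl`), |□̃| ≦ 1, |h_□| ≦ 1, supp h_□ ∩ 𝔅 ⊂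
S_□, P > 0 with scale transfer at α′_st (constant C′), ρ ≧ α′_st + ρ′, (2.61) at b − ρ′ — gen 6's
`smallFactor_term_majorant` with its hypothesis `hA` SUPPLIED by `commFactor_hA`: majorant
1_{S_□}(y′)·θ_AB₀C′c₁(δ₀, b−ρ′)·e^{−ρ′δ₀d(y,y′)}. [cite: Balaban1985BackgroundPropagators, p.412 + (3.97)] -/
theorem p412_commTerm_majorant (blk : X → g.Site) (d : ℕ) (δ₀ aG αc αst ρ ℓ₀ ℓ₁ BG C cQ cQs : ℝ)
    (PG : g.Site → ℝ) (hp : X → ℝ) (αst' ρ' b B₀ C' : ℝ) (P : g.Site → ℝ) (S : Finset g.Site) (χ h : g.Site → ℝ)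
    (hℓ₀ : 0 ≤ ℓ₀) (hℓ₁ : 0 ≤ ℓ₁) (hBG : 0 ≤ BG) (hC : 0 ≤ C) (hcQ : 0 ≤ cQ) (hcQs : 0 ≤ cQs)
    (hPG : ∀ y, 0 ≤ PG y) (hδ₀ : 0 ≤ δ₀) (hαc : 0 < αc * δ₀) (hρ : 0 ≤ ρ) (hsplit : αst + αc + ρ ≤ aG)
    (hB₀ : 0 ≤ B₀) (hC' : 0 ≤ C') (hP : ∀ y, 0 < P y) (hρ' : 0 ≤ ρ') (hsplit' : αst' + ρ' ≤ ρ)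
    (htri : B6RandomWalk.Triangle254 (B9Thm34Ext.toB6 g R H)) (hsymm : ∀ a b : g.Site, g.dist a b = g.dist b a)
    (hdnn : ∀ a b : g.Site, 0 ≤ g.dist a b)
    (hST : B9Ineq347.ScaleTransfer g δ₀ αst C PG) (hST' : B9Ineq347.ScaleTransfer g δ₀ αst' C' P)
    (h261 : B6RandomWalk.Ineq261 d (B9Thm34Ext.toB6 g R H) δ₀ (aG - ρ))
    (h261' : B6RandomWalk.Ineq261 d (B9Thm34Ext.toB6 g R H) δ₀ (b - ρ'))
    (hPP : ∀ y, PG y ^ 2 ≤ (P y)⁻¹)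
    (hh1 : ∀ x, |hp x| ≤ 1) (hLip : ∀ x x' : X, |hp x' - hp x| ≤ ℓ₀ + ℓ₁ * g.dist (blk x) (blk x'))
    (hχ1 : ∀ y, |χ y| ≤ 1) (hh1' : ∀ y, |h y| ≤ 1) (hhS : ∀ y, h y ≠ 0 → y ∈ S)
    {Qp : (X → ℝ) →ₗ[ℝ] (g.Site → ℝ)} {Qs : (g.Site → ℝ) →ₗ[ℝ] (X → ℝ)} {Gf : Module.End ℝ (X → ℝ)}
    {Cl : Module.End ℝ (g.Site → ℝ)}
    (hQ : B6RandomWalkHom.HasMajorantHom (g := B9Thm34Ext.toB6 g R H) blk (fun y : g.Site => y) Qp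
      (fun (a b : g.Site) => cQ * (if a = b then (1 : ℝ) else 0)))
    (hQs : B6RandomWalkHom.HasMajorantHom (g := B9Thm34Ext.toB6 g R H) (fun y : g.Site => y) blk Qs
      (fun (a b : g.Site) => cQs * (if a = b then (1 : ℝ) else 0)))
    (hG : B6RandomWalk.HasMajorant (g := B9Thm34Ext.toB6 g R H) blk Gf
      (fun (a b : g.Site) => BG * PG a * Real.exp (-(aG * δ₀ * g.dist a b))))
    (hCl : B6RandomWalk.HasMajorant (g := B9Thm34Ext.toB6 g R H) (fun y : g.Site => y) Cl
      (fun (y'' b' : g.Site) => B₀ * P y'' * Real.exp (-(b * δ₀ * g.dist y'' b')))) :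
    B6RandomWalk.HasMajorant (g := B9Thm34Ext.toB6 g R H) (fun y : g.Site => y)
      (mulOp χ * (Qp ∘ₗ ((Gf * (mulOp hp * mulOp hp) - (mulOp hp * mulOp hp) * Gf) * Gf) ∘ₗ Qs) *
        (mulOp h * Cl * mulOp h))
      (fun (a b' : g.Site) => (if b' ∈ S then (1 : ℝ) else 0) *
        ((cQ * cQs * (2 * ℓ₀ + 2 * ℓ₁ * (αc * δ₀)⁻¹) * BG * BG * C * B6.c1 d δ₀ (aG - ρ)) * B₀ * C' *
          B6.c1 d δ₀ (b - ρ')) * Real.exp (-(ρ' * δ₀ * g.dist a b'))) := by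
  have hA := commFactor_hA (R := R) (H := H) blk d δ₀ aG αc αst ρ ℓ₀ ℓ₁ BG C cQ cQs PG P hp hℓ₀ hℓ₁ hBG hC hcQ hcQs
    hPG hδ₀ hαc hρ hsplit htri hsymm hdnn hST h261 hPP hh1 hLip hQ hQs hG
  have hℓ : 0 ≤ 2 * ℓ₀ + 2 * ℓ₁ * (αc * δ₀)⁻¹ :=
    add_nonneg (by linarith) (mul_nonneg (by linarith) (inv_nonneg.mpr hαc.le))
  have hθ : 0 ≤ cQ * cQs * (2 * ℓ₀ + 2 * ℓ₁ * (αc * δ₀)⁻¹) * BG * BG * C * B6.c1 d δ₀ (aG - ρ) :=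
    mul_nonneg (mul_nonneg (mul_nonneg (mul_nonneg (mul_nonneg (mul_nonneg hcQ hcQs) hℓ) hBG) hBG) hC)
      (B6RandomWalk.c1_nonneg d δ₀ (aG - ρ))
  exact B9Eq395Small.smallFactor_term_majorant (R := R) (H := H) d δ₀ ρ αst' ρ' b
    (cQ * cQs * (2 * ℓ₀ + 2 * ℓ₁ * (αc * δ₀)⁻¹) * BG * BG * C * B6.c1 d δ₀ (aG - ρ)) B₀ C' P S χ h hθ hB₀ hC' hP
    hδ₀ hρ' hsplit' htri hsymm hdnn hST' h261' hχ1 hh1' hhS hA hCl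

end TwoLattice

/-! ## §4b  The first term of gen 6's `regroup_412` IS □̃·A·(h_□C_□h_□) -/

section P412

variable {V W : Type*} [AddCommGroup V] [Module ℝ V] [AddCommGroup W] [Module ℝ W]

/-- The first term □̃Q′[G′, h′²]G′Q′\*h_□C_□h_□ of the p. 412 regrouping (gen 6's `B9Eq395Small.regroup_412`, a chain of
compositions fine space V ↔ coarse space W) read as the product □̃·A·(h_□C_□h_□) in End(W) with the middle factor
A = Q′([G′, h′²]G′)Q′\* of `p412_commTerm_majorant` — associativity of composition, definitionally. [folklore] -/
theorem p412_term_eq (Q : V →ₗ[ℝ] W) (Qs : W →ₗ[ℝ] V) (Cm G : Module.End ℝ V) (Chi Hm C : Module.End ℝ W) :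
    Chi ∘ₗ Q ∘ₗ Cm ∘ₗ G ∘ₗ Qs ∘ₗ Hm ∘ₗ C ∘ₗ Hm = Chi * (Q ∘ₗ (Cm * G) ∘ₗ Qs) * (Hm * C * Hm) :=
  rfl

end P412

/-! ## §5  The third sum of (3.95) with `hL` supplied -/

section ThirdSum

variable {g : B9.Geometry} [Fintype g.Site] [DecidableEq g.Site] {R : ℝ} {H : Prop} {X : Type}

/-- **The □-term of the third sum of (3.95) from per-operator majorants**: gen 6's `thirdSum_term_majorant`
((□̃L_□h_□ − h_□□̃L_□)C_□h_□ ≺ 1_{S_□}(y′)·(ℓ₀ + ℓ₁(α_cδ₀)⁻¹)κB₀C′c₁(δ₀, b−ρ′)·e^{−ρ′δ₀d(y,y′)}) with its hypothesis `hL`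
SUPPLIED by `lloc_majorant`: κ = κ_L = c_Qc_{Q\*}B_G²C·c₁(δ₀, a_G−ρ), a_L = ρ ≧ α′_st + α_c + ρ′ (h_□ here a multiplier
on 𝔅, (ℓ₀, ℓ₁)-slowly varying in d). [cite: Balaban1985BackgroundPropagators, (3.95) p.411 + p.412] -/
theorem thirdSum_term_majorant_of_ops (blk : X → g.Site) (d : ℕ) (δ₀ aG αst ρ BG C cQ cQs : ℝ)
    (PG : g.Site → ℝ) (αc αst' ρ' b ℓ₀ ℓ₁ B₀ C' : ℝ) (P : g.Site → ℝ) (S : Finset g.Site) (χ h : g.Site → ℝ)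
    (hBG : 0 ≤ BG) (hC : 0 ≤ C) (hcQ : 0 ≤ cQ) (hcQs : 0 ≤ cQs) (hPG : ∀ y, 0 ≤ PG y) (hδ₀ : 0 ≤ δ₀)
    (hρ : 0 ≤ ρ) (hsplit : αst + ρ ≤ aG)
    (hℓ₀ : 0 ≤ ℓ₀) (hℓ₁ : 0 ≤ ℓ₁) (hB₀ : 0 ≤ B₀) (hC' : 0 ≤ C') (hP : ∀ y, 0 < P y) (hαc : 0 < αc * δ₀)
    (hρ' : 0 ≤ ρ') (hsplit' : αst' + αc + ρ' ≤ ρ)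
    (htri : B6RandomWalk.Triangle254 (B9Thm34Ext.toB6 g R H)) (hsymm : ∀ a b : g.Site, g.dist a b = g.dist b a)
    (hdnn : ∀ a b : g.Site, 0 ≤ g.dist a b)
    (hST : B9Ineq347.ScaleTransfer g δ₀ αst C PG) (hST' : B9Ineq347.ScaleTransfer g δ₀ αst' C' P)
    (h261 : B6RandomWalk.Ineq261 d (B9Thm34Ext.toB6 g R H) δ₀ (aG - ρ))
    (h261' : B6RandomWalk.Ineq261 d (B9Thm34Ext.toB6 g R H) δ₀ (b - ρ'))
    (hPP : ∀ y, PG y ^ 2 ≤ (P y)⁻¹)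
    (hχ1 : ∀ y, |χ y| ≤ 1) (hh1 : ∀ y, |h y| ≤ 1) (hhS : ∀ y, h y ≠ 0 → y ∈ S)
    (hLip : ∀ y y' : g.Site, |h y' - h y| ≤ ℓ₀ + ℓ₁ * g.dist y y')
    {Qp : (X → ℝ) →ₗ[ℝ] (g.Site → ℝ)} {Qs : (g.Site → ℝ) →ₗ[ℝ] (X → ℝ)} {Gf : Module.End ℝ (X → ℝ)}
    {Cl : Module.End ℝ (g.Site → ℝ)}
    (hQ : B6RandomWalkHom.HasMajorantHom (g := B9Thm34Ext.toB6 g R H) blk (fun y : g.Site => y) Qp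
      (fun (a b : g.Site) => cQ * (if a = b then (1 : ℝ) else 0)))
    (hQs : B6RandomWalkHom.HasMajorantHom (g := B9Thm34Ext.toB6 g R H) (fun y : g.Site => y) blk Qs
      (fun (a b : g.Site) => cQs * (if a = b then (1 : ℝ) else 0)))
    (hG : B6RandomWalk.HasMajorant (g := B9Thm34Ext.toB6 g R H) blk Gf
      (fun (a b : g.Site) => BG * PG a * Real.exp (-(aG * δ₀ * g.dist a b))))
    (hCl : B6RandomWalk.HasMajorant (g := B9Thm34Ext.toB6 g R H) (fun y : g.Site => y) Cl
      (fun (y'' b' : g.Site) => B₀ * P y'' * Real.exp (-(b * δ₀ * g.dist y'' b')))) :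
    B6RandomWalk.HasMajorant (g := B9Thm34Ext.toB6 g R H) (fun y : g.Site => y)
      ((mulOp χ * (Qp ∘ₗ (Gf * Gf) ∘ₗ Qs) * mulOp h - mulOp h * (mulOp χ * (Qp ∘ₗ (Gf * Gf) ∘ₗ Qs))) * Cl *
        mulOp h)
      (fun (a b' : g.Site) => (if b' ∈ S then (1 : ℝ) else 0) *
        ((ℓ₀ + ℓ₁ * (αc * δ₀)⁻¹) * (cQ * cQs * BG * BG * C * B6.c1 d δ₀ (aG - ρ)) * B₀ * C' *
          B6.c1 d δ₀ (b - ρ')) * Real.exp (-(ρ' * δ₀ * g.dist a b'))) := by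
  have hL := lloc_majorant (R := R) (H := H) blk d δ₀ aG αst ρ BG C cQ cQs PG P hBG hC hcQ hcQs hPG hδ₀ hρ hsplit
    htri hsymm hdnn hST h261 hPP hQ hQs hG
  have hκ : 0 ≤ cQ * cQs * BG * BG * C * B6.c1 d δ₀ (aG - ρ) :=
    mul_nonneg (mul_nonneg (mul_nonneg (mul_nonneg (mul_nonneg hcQ hcQs) hBG) hBG) hC)
      (B6RandomWalk.c1_nonneg d δ₀ (aG - ρ))
  exact B9Eq395Small.thirdSum_term_majorant (R := R) (H := H) d δ₀ ρ αc αst' ρ' b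
    (cQ * cQs * BG * BG * C * B6.c1 d δ₀ (aG - ρ)) ℓ₀ ℓ₁ B₀ C' P S χ h hκ hℓ₀ hℓ₁ hB₀ hC' hP hδ₀ hαc hρ' hsplit'
    htri hsymm hdnn hST' h261' hχ1 hh1 hhS hLip hL hCl

end ThirdSum

end Literature.MathematicalPhysics.QuantumFieldTheory.Balaban1983to89.B9Eq395Hom
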